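import Summits.CriticalPhenomena.CardyFormulaZ2.Theses.CardySusyWard
import Summits.CriticalPhenomena.CardyFormulaZ2.Theses.CardyComplexCone
import Literature.Barriers.CriticalPhenomena.FKParafermionicHalfCauchyRiemann

/-!
# Sketch — crux-ideate stmt-CriticalPhenomena-11293 (`ParafermionPrecompact`), ideator 1, round 1

First-lemma signatures for the two idea cards of this seat.  Nothing below is load-bearing for the
route; every `def … : Prop` elaborates over existing declarations, and the two small lemmas that are
PROVED (`fourClasses_medialCornersAt`, `classes_pairwise_ne`) are finite bookkeeping.

* Card `four-class-vertex-transfer`: each medial vertex of `ℤ²` is incident to exactly one dart of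
  each of the four corner classes `f - v ∈ {0, -e₀, -e₀-e₁, -e₁}` (`fourClasses_medialCornersAt`);
  the vertex passage phase is the fixed multiple `1/(2 cos(π/12))` of the sum of the incoming and
  outgoing dart phases (`VertexDartSplit`); hence the REPAIRED crux
  `Disproof.ParafermionPrecompactRepaired` (C′) follows from the twin crux
  `CardyComplexCone.EdgePrecompact` by bookkeeping (`RepairedOfEdgePrecompact`), and vertex
  equicontinuity needs no cross-class (`EdgeCoherence`) input.
* Card `rs-meander-strip-profile`: the topological input of the meander kernel — a lattice
  excursion in a half-plane turns by strictly less than a full turn, with sign fixed by the order of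
  its endpoints on the wall (`ExcursionHalfTurn`) — and the shape of the line's claims
  (`StripProfileTarget`, prose).
-/

noncomputable section

namespace Summit.CriticalPhenomena.CardyFormulaZ2.Cruxes.ParafermionPrecompact.IdeatorOne

open scoped BigOperators Topology
open Filter Set MeasureTheory
open Literature.Probability.LatticeModels Literature.Probability.RandomPlanarGeometry
  Literature.Probability.Percolation
open Literature.Barriers.CriticalPhenomena

/-! ## Read-back of the repaired crux C′ (verbatim copy of `Disproof.ParafermionPrecompactRepaired`,
`Cruxes/ParafermionPrecompact/Disproof.lean` §5, whose module is not in the farm build; kept in sync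
by hand) -/

/-- The observable of the crux. -/
def F (Λ : ℝ → DiscreteDobrushin) (δ : ℝ) (z : MedialVertex) : ℂ :=
  ∫ ω, MedialPath.passageSum (medialExploration (Λ δ) ω) δ (1 / 3) z ∂(bondPercolation (zdGraph 2) half)

/-- The six family hypotheses of the crux. -/
def IsFamily (D : DobrushinDomain) (Λ : ℝ → DiscreteDobrushin) : Prop :=
  (∀ δ, (Λ δ).Ω = D.carrier) ∧ (∀ δ, (Λ δ).δ = δ) ∧
  Tendsto (fun δ : ℝ => Metric.hausdorffEDist (Λ δ).arcA (D.arc 0)) (𝓝[>] 0) (𝓝 0) ∧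
  Tendsto (fun δ : ℝ => Metric.hausdorffEDist (Λ δ).arcB (D.arc 1)) (𝓝[>] 0) (𝓝 0) ∧
  Tendsto (fun δ : ℝ => Metric.hausdorffEDist (medialPoint δ '' (Λ δ).zdABEdges) {D.pt 0, D.pt 1})
    (𝓝[>] 0) (𝓝 0) ∧
  (∀ᶠ δ in 𝓝[>] 0, (Λ δ).IsZdAdmissible)

/-- C′ = the crux with the two `edgeSet` guards (refuters' repair; believed true, open). -/
def ParafermionPrecompactRepaired : Prop :=
  ∀ (D : DobrushinDomain) (Λ : ℝ → DiscreteDobrushin), IsFamily D Λ →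
    ∀ K : Set ℂ, IsCompact K → K ⊆ D.carrier →
      (∃ C : ℝ, ∀ᶠ δ in 𝓝[>] 0, ∀ z : MedialVertex, z ∈ (zdGraph 2).edgeSet →
        medialPoint δ z ∈ K → ‖F Λ δ z‖ ≤ C * δ ^ ((1:ℝ) / 3)) ∧
      (∀ ε > (0:ℝ), ∃ η > (0:ℝ), ∀ᶠ δ in 𝓝[>] 0, ∀ z z' : MedialVertex,
        z ∈ (zdGraph 2).edgeSet → z' ∈ (zdGraph 2).edgeSet →
        medialPoint δ z ∈ K → medialPoint δ z' ∈ K → dist (medialPoint δ z) (medialPoint δ z') < η →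
          ‖F Λ δ z - F Λ δ z'‖ ≤ ε * δ ^ ((1:ℝ) / 3))

/-- Read-back: the crux AS TYPED implies C′ (C′ is a weakening; cf. Disproof §5). -/
def RepairedOfTyped : Prop :=
  Theses.CardySusyWard.ParafermionPrecompact → ParafermionPrecompactRepaired

/-- Unit lattice vectors. -/
abbrev e0 : Site 2 := Pi.single 0 1
abbrev e1 : Site 2 := Pi.single 1 1

/-! ## Card `four-class-vertex-transfer` -/

/-- The corner class (offset `f - v`) of the `k`-th dart at the medial vertex `s(x, x + eᵢ)`,
read off the barrier file's certified clockwise list `medialCornersAt x i`. -/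
def classAt (x : Site 2) (i : Fin 2) (k : Fin 4) : Site 2 :=
  (medialCornersAt x i k).2 - (medialCornersAt x i k).1

/-- **Four-class incidence (PROVED).** At every medial vertex of `ℤ²` the four incident darts carry
the four classes `0, -e₀, -e₀-e₁, -e₁`, each exactly once: for a horizontal edge (`i = 0`) in the
clockwise order `NW, NE, SE, SW` the classes are `0, -e₀, -e₀-e₁, -e₁`; for a vertical edge
(`i = 1`) they are `-e₀-e₁, -e₁, 0, -e₀`. -/
theorem fourClasses_medialCornersAt (x : Site 2) :
    (classAt x 0 0 = 0 ∧ classAt x 0 1 = -e0 ∧ classAt x 0 2 = -e0 - e1 ∧ classAt x 0 3 = -e1) ∧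
    (classAt x 1 0 = -e0 - e1 ∧ classAt x 1 1 = -e1 ∧ classAt x 1 2 = 0 ∧ classAt x 1 3 = -e0) := by
  refine ⟨⟨?_, ?_, ?_, ?_⟩, ⟨?_, ?_, ?_, ?_⟩⟩ <;>
    (ext j; fin_cases j <;> simp [classAt, medialCornersAt, e0, e1])

/-- The four classes are pairwise distinct (so "one dart of each class" at every medial vertex).
(PROVED.) -/
theorem classes_pairwise_ne :
    (0 : Site 2) ≠ -e0 ∧ (0 : Site 2) ≠ -e0 - e1 ∧ (0 : Site 2) ≠ -e1 ∧
      -e0 ≠ -e0 - e1 ∧ (-e0 : Site 2) ≠ -e1 ∧ -e0 - e1 ≠ -e1 := by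
  refine ⟨?_, ?_, ?_, ?_, ?_, ?_⟩ <;> intro h
  · have := congrFun h 0; simp [e0] at this
  · have := congrFun h 0; simp [e0, e1] at this
  · have := congrFun h 1; simp [e1] at this
  · have := congrFun h 1; simp [e0, e1] at this
  · have := congrFun h 0; simp [e0, e1] at this
  · have := congrFun h 0; simp [e0, e1] at this

/-- **Vertex/dart split (pathwise, to prove).** For the medial exploration path `γ` of admissible
data and an interior position `k` (`0 < k`, `k + 1 < γ.length`), consecutive darts are
perpendicular, so the vertex passage phase at `γ[k]` — built on the mid-turn winding
`windingAt γ δ k = (W_in + W_out)/2` with `W_out = W_in ± π/2` — is the fixed real multiple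
`1 / (2 cos (π/12))` of the sum of the incoming and outgoing DART phases
`exp(-(i/3) W_in) + exp(-(i/3) W_out)` (the dart phase being the integrand of
`CardyComplexCone.EdgePrecompact`).  Elementary: `(e^{-ia} + e^{-ib})/2 = e^{-i(a+b)/2} cos((a-b)/2)`. -/
def VertexDartSplit : Prop :=
  ∀ (D : DiscreteDobrushin) (ω : BondConfig (Site 2)) (k : ℕ), D.IsZdAdmissible →
    0 < k → k + 1 < (medialExploration D ω).length →
    let γ := medialExploration D ω
    let pts := γ.map (medialPoint D.δ)
    Complex.exp (-(Complex.I / 3) * (MedialPath.windingAt γ D.δ k : ℝ)) *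
        (2 * Real.cos (Real.pi / 12) : ℝ) =
      Complex.exp (-(Complex.I / 3) * (Polyline.winding (pts.take (k + 1)) : ℝ)) +
        Complex.exp (-(Complex.I / 3) * (Polyline.winding (pts.take (k + 2)) : ℝ))

/-- **Transfer target of the card (to prove: bookkeeping + `VertexDartSplit` +
`fourClasses_medialCornersAt`).**  The twin crux `EdgePrecompact` of route `CardyComplexCone`
(stmt-CriticalPhenomena-11387: δ^{-1/3}·(dart observable) bounded on compacts and equicontinuous
CLASS BY CLASS, for every family with `(Λ δ).Ω = D`, mesh `δ`, eventually admissible — a SUPERSET of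
the families of this crux) implies the REPAIRED crux C′ = `ParafermionPrecompactRepaired` (= `Disproof.ParafermionPrecompactRepaired`):
(i) `‖F_δ(z)‖ ≤ (2/cos(π/12)) · max_darts ‖E_δ‖`; (ii) for two genuine medial vertices `z, z'` the
difference `F_δ(z) - F_δ(z')` is `1/(2cos(π/12))` times a sum of FOUR SAME-CLASS dart differences
(one per class, darts at distance `≤ dist(z,z') + 2δ`), so class-by-class equicontinuity suffices
and no cross-class coherence (`EdgeCoherence`) is used.  NOT claimed for the crux AS TYPED, which is
`¬ ParafermionBulkNondegenerate` (`Disproof.parafermionPrecompact_iff_not_bulkNondegenerate`). -/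
def RepairedOfEdgePrecompact : Prop :=
  Theses.CardyComplexCone.EdgePrecompact → ParafermionPrecompactRepaired

/-! ## Card `rs-meander-strip-profile` -/

/-- **Excursion half-turn lemma (topological input of the meander kernel; to prove with the tree's
Hopf/Umlaufsatz files).**  A simple medial polyline (pairwise distinct genuine medial vertices,
consecutive entries forming medial darts) that starts and ends ON the vertical wall `Re = 0` and
otherwise stays strictly to its right turns in total by STRICTLY LESS than a full turn, and the sign
of its total turning is the order of its endpoints along the wall: `0 < W ↔` it ends above where it
started.  (Close the excursion by the wall segment: a simple closed lattice curve has rotation `±2π`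
and the two wall corners absorb a known part.)  Consequence used by the card: the winding of the
Dobrushin interface at each of its crossings of a cross-section is a deterministic function of the
MEANDER (the pair of link patterns induced below and above the section), so the spin-1/3 observable
restricted to the section is a finite bilinear form in the two half-strip link-pattern laws. -/
def ExcursionHalfTurn : Prop :=
  ∀ (γ : List MedialVertex) (a b : MedialVertex), γ.Nodup → List.IsChain IsMedialDart γ →
    3 ≤ γ.length → γ.head? = some a → γ.getLast? = some b →
    (medialPoint 1 a).re = 0 → (medialPoint 1 b).re = 0 →
    (∀ e ∈ γ, e ≠ a → e ≠ b → 0 < (medialPoint 1 e).re) →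
      |Polyline.winding (γ.map (medialPoint 1))| < 2 * Real.pi ∧
        (0 < Polyline.winding (γ.map (medialPoint 1)) ↔ (medialPoint 1 a).im < (medialPoint 1 b).im)

/-- **Shape of the strip-profile target (prose carrier; the integrable content is not typeable in the
tree today).**  `StripProfileTarget c C` records the two-sided bound the card wants for the q = 1,
spin-1/3 dart observable in the DIAGONAL Dobrushin strip of the medial lattice of odd width `L`
(wired / free walls, Ikhlef–Ponsaing 2012 geometry): for every class and every row at distance
`≥ L/4` from both walls, `c · L^{-1/3} ≤ ‖F(row; L)‖ ≤ C · L^{-1/3}`, uniformly in `L`.  Here it is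
only a named pair of constants with `0 < c ≤ C`; the statement proper lives in the card. -/
def StripProfileTarget (c C : ℝ) : Prop := 0 < c ∧ c ≤ C

end Summit.CriticalPhenomena.CardyFormulaZ2.Cruxes.ParafermionPrecompact.IdeatorOne

end
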